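import Literature.NumberTheory.GaloisCohomology.Howard2004.TowerZModLeftKernelPairingProofs
import Literature.NumberTheory.Automorphic.TunnellLemma
import Summits.BirchSwinnertonDyer.BirchSwinnertonDyer.Theorems.SchneiderFreeAdditiveX3PoitouTateShaDualityHolds
import Summits.BirchSwinnertonDyer.BirchSwinnertonDyer.Theorems.PoitouTateSelmerStructureDualityConjHolds
import Summits.BirchSwinnertonDyer.BirchSwinnertonDyer.Theorems.HowardThm161PrintIntendedOfProp141Intended
import HarnessLib

/-!
# Stub `stub_thm161` (K2a″) of line `beta-road` v13 on crux r205 stmt-BirchSwinnertonDyer-24737 `TwinAlgMuZeroAtThree` — CLOSED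
# by cell x9's kernel theorem: Howard 2004 Thm. 1.6.1 AS INTENDED BY ITS PRINTED PROOF (F-161′) holds unconditionally

Summits-side stub file (`--supports stmt-BirchSwinnertonDyer-24737`; registered skeleton beta-road v13 sha16 68624b5c92c16bea, LEAD lineage
`bsd-wall-utd-p1`, g27).  ONE theorem, no definition, no named fact, no `sorry`.

The registered stub asks for the tree's print-as-intended fact `Howard2004.thm161_dvrKolyvaginBound_printIntended` (Howard's DVR Kolyvagin
bound, Thm. 1.6.1, with the two printed-proof guards `(p : R) ≠ 0`, `p ∤ #𝓞_K^×`).  Cell `pub/bsd-print-x9` proved it in the kernel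
(2026-08-29): the class-level port of Flach's generalised Cassels–Tate pairing on Howard's level tower
(`prop141_casselsTate_skewPairing_atLevel_printIntended_of_poitouTate`, fed with the tree's Čebotarev and Poitou–Tate theorems) composed with
the G87 engine's closing theorem `DVRSetting.thm161_printIntended_of_prop141_printIntended` —
`DVRSetting.thm161_printIntended_of_prop141_printIntended` — `HowardFlachSkewPairingIntended.thm161_printIntended_holds` (that file
imports the route files `Theses.PrintX9/PrintX10b`, so — to stay route-independent — this file repeats its three-line composition from the
route-free modules instead of importing it).  No summit statement is proved; BSD is not proved by this.

References: [Howard2004HeegnerKolyvagin] Thm. 1.6.1, Prop. 1.4.1, Thm. 1.4.2 (arXiv:1202.6340 Thm. 2.6.1, Prop. 2.4.1, Thm. 2.4.2); [Flach1990] Thm. 1–2.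
-/

set_option linter.dupNamespace false
set_option autoImplicit false

namespace Summit.BirchSwinnertonDyer.BirchSwinnertonDyer.Cruxes.TwinAlgMuZeroAtThree.BetaRoad

/-- **`stub_thm161` (K2a″ of beta-road v13) — Howard 2004, Thm. 1.6.1 as intended by its printed proof (F-161′)**: for every `DVRSetting`
with H.0–H.5, `p ≠ 0` in `R`, `p ∤ #𝓞_K^×`, `LargePrimes` and a Kolyvagin system with `κ₁ ≠ 0`, Howard's `Conclusion` holds.  Cell x9's
unconditional kernel composition (route-free): C45.1″ from Čebotarev for Artin representations and the two Poitou–Tate dualities (all theorems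
of the tree), then the G87 engine's `thm161_printIntended_of_prop141_printIntended`.
[cite: Howard2004HeegnerKolyvagin, Thm. 1.6.1 (arXiv:1202.6340 Thm. 2.6.1, p. 11 L17–32), Prop. 1.4.1, Thm. 1.4.2] [cite: Flach1990, Thm. 1 and Thm. 2] -/
theorem stub_thm161 : Literature.NumberTheory.GaloisCohomology.Howard2004.thm161_dvrKolyvaginBound_printIntended :=
  Summit.BirchSwinnertonDyer.BirchSwinnertonDyer.Theorems.HowardThm161PrintIntended.thm161_printIntended_of_prop141_printIntended
    (Literature.NumberTheory.GaloisCohomology.Howard2004.prop141_casselsTate_skewPairing_atLevel_printIntended_of_poitouTate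
      Literature.NumberTheory.Automorphic.chebotarev_artinRep_of_galoisSide
      (fun K _ _ => Summit.BirchSwinnertonDyer.BirchSwinnertonDyer.Theorems.SchneiderFreeAdditiveX3.PoitouTateReduction.poitouTate_sha_tateDual_holds K)
      (fun K _ _ => Summit.BirchSwinnertonDyer.BirchSwinnertonDyer.Theorems.InputsPoitouTateSelmer.poitouTate_selmerStructure_duality_conj_holds K))

end Summit.BirchSwinnertonDyer.BirchSwinnertonDyer.Cruxes.TwinAlgMuZeroAtThree.BetaRoad
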